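import Summits.AtomisticToContinuum.Crystallization.Theorems.FluxTubeKeplerFluxCellKeplerPricingConsequences
import Summits.AtomisticToContinuum.Crystallization.Theorems.FluxTubeKeplerFluxCellKeplerEnergyIdentity
import Summits.AtomisticToContinuum.Crystallization.Theorems.FluxCellKepler.Negative.LayeredMinimiser

/-!
# `FluxCellKepler` (stmt-AtomisticToContinuum-15221), line `Sketch` — the glue of the line's cut,
# landed sorry-free, and the `P₀`-free form of the crux

Lead prover (continuation c2).  The line's skeleton `Cruxes/FluxCellKepler/Lines/Sketch.lean`
composes the crux from two registered stubs; this file lands the COMPOSITION itself (no `sorry`,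
hypotheses inline, nothing asserted), so that a planner who promotes the τ-free stub to a statement
item can split the crux with `--glue-by` this declaration:

* `fluxCellKepler_of_pricing_of_coercive` —
  `stub_defectPricedExcess → stub_coerciveFluxCells → FluxCellKepler`:
  the τ-free defect pricing (`c · #bad ≤ E_LJ − N e⋆` on `δ`-separated configurations; it is
  summit-strength, `crystallization_of_defectPricing`) and the coercive flux-cell localisation
  (`∃ R₁ τ`, DOM on all finite injective configurations and, for every `δ`, some `θ < 1` with
  `Σ τ − Σ site₆ ≤ 12 θ (E_LJ − N e⋆)` on `δ`-separated ones) give the crux, with the periodic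
  minimiser `P₀` taken from `crysPeriodicMinAttained_of_defectPricing` and `c' = (1 − θ) c`;
* `fluxCellKepler_iff_eStar` — the `P₀`-FREE FORM: `FluxCellKepler ↔ ∃ R₁ τ, Dom R₁ τ ∧ Kepler⋆ R₁ τ`
  where `Kepler⋆` is KEPLER with the periodic infimum `e⋆ = ⨅_Q e(Q)` in place of `e(P₀)`
  (`→`: `e(P₀) = e⋆` for every witness, `Negative.witness_energy_eq_eStar`; `←`: DOM + KEPLER⋆ give
  the pricing, hence a periodic minimiser `P₀` with `e(P₀) = e⋆`).  The `∃ P₀` of the crux is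
  therefore cosmetic: attainment is a consequence, not an input.

All `[folklore]`.
-/

namespace Summit.AtomisticToContinuum.Crystallization.Theorems.FluxCellKeplerSketch

open scoped BigOperators
open Literature.MathematicalPhysics.StatisticalMechanics
open Summit.AtomisticToContinuum.Crystallization.Theses.FluxTubeKepler

/-- **The line's composition, sorry-free**: τ-free defect pricing (`stub_defectPricedExcess`,
verbatim) and coercive flux-cell localisation (`stub_coerciveFluxCells`, verbatim) imply
`FluxCellKepler`.  Take a periodic minimiser `P₀` (`crysPeriodicMinAttained_of_defectPricing`), so
`e(P₀) = e⋆`; `(R₁, τ)` and DOM from the localisation; given `δ, R, η` take `θ < 1` and the pricing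
constant `c` and put `c' = (1 − θ) c`: by the energy identity
`Σ_i ((1/24) site₁₂ − (1/12) τ_i) = E − (Σ τ − Σ site₆)/12 ≥ E − θ (E − N e⋆)`, so the cell sum
exceeds `N e⋆` by at least `(1 − θ)(E − N e⋆) ≥ (1 − θ) c · #bad`. [folklore] -/
theorem fluxCellKepler_of_pricing_of_coercive
    (h₂ : ∀ δ : ℝ, 0 < δ → ∀ R η : ℝ, 0 < R → 0 < η → ∃ c : ℝ, 0 < c ∧ ∀ (N : ℕ) (x : Fin N → EuclideanSpace ℝ (Fin 3)), Function.Injective x → (∀ i j, i ≠ j → δ ≤ dist (x i) (x j)) → c * (Nat.card {i : Fin N // ¬ ∃ a : ℝ, 47 / 50 ≤ a ∧ a ≤ 1 ∧ ∃ (A : EuclideanSpace ℝ (Fin 3) →ₗᵢ[ℝ] EuclideanSpace ℝ (Fin 3)) (s : ℤ → ℤ) (z : ℤ → ℝ), IsHaggSeq s ∧ (∀ m : ℤ, 39 / 50 * a ≤ z (m + 1) - z m ∧ z (m + 1) - z m ≤ 17 / 20 * a) ∧ let S : Set (EuclideanSpace ℝ (Fin 3)) := {p | ∃ m k l : ℤ,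 p = A (((k : ℝ) • triangularVec₁ a) + ((l : ℝ) • triangularVec₂ a) + ((haggLabel s m : ℝ) • barlowOffset a) + (z m • layerNormal 1))}; (∀ p ∈ S, ‖p‖ ≤ R → ∃ j : Fin N, dist (x j - x i) p ≤ η) ∧ (∀ j : Fin N, ‖x j - x i‖ ≤ R → ∃ p ∈ S, dist (x j - x i) p ≤ η)} : ℝ) ≤ interactionEnergy lennardJones x - (N : ℝ) * ⨅ Q : PeriodicConfiguration 3, Q.energyPerParticle lennardJones)
    (h₃ : ∃ (R₁ : ℝ) (τ : Finset (EuclideanSpace ℝ (Fin 3)) → ℝ), (∀ (N : ℕ) (x : Fin N → EuclideanSpace ℝ (Fin 3)), Function.Injective x → ∑ i, siteEnergy (fun r => (r⁻¹) ^ 6) x i ≤ ∑ i, τ ((Finset.univ.filter fun j : Fin N => dist (x j) (x i) ≤ R₁).image fun j => x j - x i)) ∧ (∀ δ : ℝ, 0 < δ → ∃ θ : ℝ, θ < 1 ∧ ∀ (N : ℕ) (x : Fin N → EuclideanSpace ℝ (Fin 3)), Function.Injective x → (∀ i j, i ≠ j → δ ≤ dist (x i) (x j)) → ∑ i, τ ((Finset.univ.filter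 fun j : Fin N => dist (x j) (x i) ≤ R₁).image fun j => x j - x i) - ∑ i, siteEnergy (fun r => (r⁻¹) ^ 6) x i ≤ 12 * θ * (interactionEnergy lennardJones x - (N : ℝ) * ⨅ Q : PeriodicConfiguration 3, Q.energyPerParticle lennardJones))) :
    FluxCellKepler := by
  obtain ⟨P₀, hP₀⟩ := crysPeriodicMinAttained_of_defectPricing h₂
  obtain ⟨R₁, τ, hdom, hsharp⟩ := h₃
  have he : (⨅ Q : PeriodicConfiguration 3, Q.energyPerParticle lennardJones)
      = P₀.energyPerParticle lennardJones := by
    rw [← sInf_range]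
    exact hP₀.csInf_eq
  refine ⟨P₀, R₁, τ, hdom, ?_⟩
  intro δ hδ R η hR hη
  obtain ⟨θ, hθ, hθb⟩ := hsharp δ hδ
  obtain ⟨c, hc, hcb⟩ := h₂ δ hδ R η hR hη
  refine ⟨(1 - θ) * c, mul_pos (sub_pos.2 hθ) hc, ?_⟩
  intro N x hx hsep
  have hG := hcb N x hx hsep
  have hL := hθb N x hx hsep
  rw [he] at hG hL
  have hsum : ∑ i, ((1 / 24 : ℝ) * siteEnergy (fun r => (r⁻¹) ^ 12) x i
        - (1 / 12 : ℝ) * τ ((Finset.univ.filter fun j : Fin N => dist (x j) (x i) ≤ R₁).image fun j => x j - x i))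
      = interactionEnergy lennardJones x
        - (1 / 12 : ℝ) * (∑ i, τ ((Finset.univ.filter fun j : Fin N => dist (x j) (x i) ≤ R₁).image fun j => x j - x i)
            - ∑ i, siteEnergy (fun r => (r⁻¹) ^ 6) x i) := by
    rw [interactionEnergy_lennardJones_eq_sum, Finset.sum_sub_distrib, Finset.sum_sub_distrib,
      ← Finset.mul_sum, ← Finset.mul_sum, ← Finset.mul_sum]
    ring
  rw [hsum]
  have h1 : (1 - θ) * (c * (Nat.card {i : Fin N // ¬ ∃ a : ℝ, 47 / 50 ≤ a ∧ a ≤ 1 ∧ ∃ (A : EuclideanSpace ℝ (Fin 3) →ₗᵢ[ℝ] EuclideanSpace ℝ (Fin 3)) (s : ℤ → ℤ) (z : ℤ → ℝ), IsHaggSeq s ∧ (∀ m : ℤ, 39 / 50 * a ≤ z (m + 1) - z m ∧ z (m + 1) - z m ≤ 17 / 20 * a) ∧ let S : Set (EuclideanSpace ℝ (Fin 3)) := {p | ∃ m k l : ℤ, p = A (((k : ℝ) • triangularVec₁ a) + ((l : ℝ) • triangularVec₂ a) + ((haggLabel s m : ℝ) • barlowOffset a) + (z m • layerNormal 1))}; (∀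 p ∈ S, ‖p‖ ≤ R → ∃ j : Fin N, dist (x j - x i) p ≤ η) ∧ (∀ j : Fin N, ‖x j - x i‖ ≤ R → ∃ p ∈ S, dist (x j - x i) p ≤ η)} : ℝ))
      ≤ (1 - θ) * (interactionEnergy lennardJones x - (N : ℝ) * P₀.energyPerParticle lennardJones) :=
    mul_le_mul_of_nonneg_left hG (sub_nonneg.2 hθ.le)
  nlinarith [h1, hL]

/-- KEPLER with the periodic infimum `e⋆` in place of `e(P₀)` (the `P₀`-free Kepler clause).
[folklore] -/
def KeplerStar (R₁ : ℝ) (τ : Finset (EuclideanSpace ℝ (Fin 3)) → ℝ) : Prop :=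
  ∀ δ : ℝ, 0 < δ → ∀ R η : ℝ, 0 < R → 0 < η → ∃ c : ℝ, 0 < c ∧ ∀ (N : ℕ)
    (x : Fin N → EuclideanSpace ℝ (Fin 3)), Function.Injective x →
    (∀ i j, i ≠ j → δ ≤ dist (x i) (x j)) →
    c * (Nat.card {i : Fin N // ¬ ∃ a : ℝ, 47 / 50 ≤ a ∧ a ≤ 1 ∧
      ∃ (A : EuclideanSpace ℝ (Fin 3) →ₗᵢ[ℝ] EuclideanSpace ℝ (Fin 3)) (s : ℤ → ℤ) (z : ℤ → ℝ),
      IsHaggSeq s ∧ (∀ m : ℤ, 39 / 50 * a ≤ z (m + 1) - z m ∧ z (m + 1) - z m ≤ 17 / 20 * a) ∧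
      let S : Set (EuclideanSpace ℝ (Fin 3)) := {p | ∃ m k l : ℤ, p = A (((k : ℝ) • triangularVec₁ a) +
        ((l : ℝ) • triangularVec₂ a) + ((haggLabel s m : ℝ) • barlowOffset a) + (z m • layerNormal 1))};
      (∀ p ∈ S, ‖p‖ ≤ R → ∃ j : Fin N, dist (x j - x i) p ≤ η) ∧
        (∀ j : Fin N, ‖x j - x i‖ ≤ R → ∃ p ∈ S, dist (x j - x i) p ≤ η)} : ℝ) ≤
    ∑ i, ((1 / 24 : ℝ) * siteEnergy (fun r => (r⁻¹) ^ 12) x i - (1 / 12 : ℝ) *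
      τ ((Finset.univ.filter fun j : Fin N => dist (x j) (x i) ≤ R₁).image fun j => x j - x i)) -
      (N : ℝ) * ⨅ Q : PeriodicConfiguration 3, Q.energyPerParticle lennardJones

/-- **DOM + KEPLER⋆ give the τ-free pricing** (`c · #bad ≤ E_LJ − N e⋆`): subtract DOM/12 from
KEPLER⋆ and use the energy identity. [folklore] -/
theorem pricing_of_dom_keplerStar {R₁ : ℝ} {τ : Finset (EuclideanSpace ℝ (Fin 3)) → ℝ}
    (hD : FluxCellKepler.Negative.Dom R₁ τ) (hK : KeplerStar R₁ τ) :
    ∀ δ : ℝ, 0 < δ → ∀ R η : ℝ, 0 < R → 0 < η → ∃ c : ℝ, 0 < c ∧ ∀ (N : ℕ) (x : Fin N → EuclideanSpace ℝ (Fin 3)), Function.Injective x → (∀ i j, i ≠ j → δ ≤ dist (x i) (x j)) → c * (Nat.card {i : Fin N // ¬ ∃ a : ℝ, 47 / 50 ≤ a ∧ a ≤ 1 ∧ ∃ (A : EuclideanSpace ℝ (Fin 3) →ₗᵢ[ℝ] EuclideanSpace ℝ (Fin 3)) (s : ℤ → ℤ) (z : ℤ → ℝ), IsHaggSeq s ∧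 (∀ m : ℤ, 39 / 50 * a ≤ z (m + 1) - z m ∧ z (m + 1) - z m ≤ 17 / 20 * a) ∧ let S : Set (EuclideanSpace ℝ (Fin 3)) := {p | ∃ m k l : ℤ, p = A (((k : ℝ) • triangularVec₁ a) + ((l : ℝ) • triangularVec₂ a) + ((haggLabel s m : ℝ) • barlowOffset a) + (z m • layerNormal 1))}; (∀ p ∈ S, ‖p‖ ≤ R → ∃ j : Fin N, dist (x j - x i) p ≤ η) ∧ (∀ j : Fin N, ‖x j - x i‖ ≤ R → ∃ p ∈ S, dist (x j - x i) p ≤ η)} : ℝ) ≤ interactionEnergy lennardJones x - (N : ℝ) * ⨅ Q : PeriodicConfiguration 3, Q.energyPerParticle lennardJones := by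
  intro δ hδ R η hR hη
  obtain ⟨c, hc, hKc⟩ := hK δ hδ R η hR hη
  refine ⟨c, hc, fun N x hx hsep => ?_⟩
  have h1 := hKc N x hx hsep
  have h2 := hD N x hx
  rw [interactionEnergy_lennardJones_eq_sum]
  rw [Finset.sum_sub_distrib, ← Finset.mul_sum, ← Finset.mul_sum] at h1 ⊢
  linarith

/-- **The `P₀`-free form of the crux**: `FluxCellKepler ↔ ∃ R₁ τ, Dom R₁ τ ∧ Kepler⋆ R₁ τ`.
[folklore] -/
theorem fluxCellKepler_iff_eStar :
    FluxCellKepler ↔ ∃ (R₁ : ℝ) (τ : Finset (EuclideanSpace ℝ (Fin 3)) → ℝ),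
      FluxCellKepler.Negative.Dom R₁ τ ∧ KeplerStar R₁ τ := by
  constructor
  · rintro ⟨P₀, R₁, τ, hD, hK⟩
    have he : P₀.energyPerParticle lennardJones =
        ⨅ Q : PeriodicConfiguration 3, Q.energyPerParticle lennardJones :=
      FluxCellKepler.Negative.witness_energy_eq_eStar hD hK
    refine ⟨R₁, τ, hD, ?_⟩
    intro δ hδ R η hR hη
    obtain ⟨c, hc, hKc⟩ := hK δ hδ R η hR hη
    refine ⟨c, hc, fun N x hx hsep => ?_⟩
    have := hKc N x hx hsep
    rwa [he] at this
  · rintro ⟨R₁, τ, hD, hK⟩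
    obtain ⟨P₀, hP₀⟩ := crysPeriodicMinAttained_of_defectPricing (pricing_of_dom_keplerStar hD hK)
    have he : (⨅ Q : PeriodicConfiguration 3, Q.energyPerParticle lennardJones)
        = P₀.energyPerParticle lennardJones := by
      rw [← sInf_range]
      exact hP₀.csInf_eq
    refine ⟨P₀, R₁, τ, hD, ?_⟩
    intro δ hδ R η hR hη
    obtain ⟨c, hc, hKc⟩ := hK δ hδ R η hR hη
    refine ⟨c, hc, fun N x hx hsep => ?_⟩
    have := hKc N x hx hsep
    rwa [he] at this

end Summit.AtomisticToContinuum.Crystallization.Theorems.FluxCellKeplerSketch
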